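import Summits.Parity.GeneralizedHardyLittlewood.Theorems.LeeYangFibresRelativeDimOneMoebiusSplitSingularSeriesAux9
import HarnessLib

/-!
# Crux `RelativeDimOne` (stmt-Parity-14113), line `single-moebius-split`: the stub `stub_tssInduction`
# (T1b-A — the induction on the number of variables of the truncated singular series)

`stub_tssInduction : ∀ t, TSSInduction t`: the `t`-variable Goldston–Yıldırım sum with general local data
(windows `W_p`, root sets `Z_{p,i}`, frozen primes `P`, rough primes `Q`) equals `∏_{p<y} β_p(W, Z)` up to
`C κ^{|P|} (∏_{p∈Q}(p/(p−1))^t) (∏_{p∈P} |W_p|/p) (log Rmax)^m e^{−c√log Rmin}`. Induction on `t`: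

* `t = 0`: both sides are `∏_{p<y} |W_p|/p` (`TSSInd.base`, aux 9);
* `t → t + 1` (`TSSInd.step`): peel the last variable `x` (`tssI_gySum_peel`, aux 6); the inner `t`-variable sums of
  the conditioned data `W^{(x)}_p = W_p ∩ Z_{p,t}` (`p ∣ x`) are, by the induction hypothesis applied with the frozen
  set `P ∪ pf(x)` (`tssI_inner`, aux 9), their main terms `∏_{p<y}(A_p 1_{p∣x} + B_p 1_{p∤x})` up to errors whose sum
  over `x` is controlled by a divisor-type sum and Mertens (`tssI_inner_sum`, `tssI_sum_frozen_weights`, aux 8/9);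
  the main terms summed against `μ(x) log(R_t/x)` are the one-variable lemma with frozen primes `tss_ovl` for the
  twist `A_p/B_p` (`tssI_main`, aux 7), whose main term recombines to `∏_{p<y} β^{t+1}_p(W, Z)`
  (`β^{t+1}_p = (p/(p−1))(B_p − A_p)`). Constants: `c_{t+1} = min(c_t, c_ovl)`, `m_{t+1} = m_t + Λ + 1`
  (`κ_t ≤ Λ ∈ ℕ`), `κ_{t+1} = 2^{t+2} κ_t`, `C_{t+1}(B) = C_ovl(2t+2, B) + C_t(B) e^{4Λ}`.

References: D. A. Goldston, C. Y. Yıldırım, Integers 3 (2003) A5 = arXiv:math/0111212, Lemma 2.1, §2–3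
[GoldstonYildirim2001]; B. Green, T. Tao, Ann. of Math. 171 (2010), App. D [GreenTao2010].
-/

noncomputable section

open Finset Real
open scoped BigOperators

namespace Summit.Parity.GeneralizedHardyLittlewood.Cruxes.RelativeDimOne.SingleMoebiusSplit

namespace TSSInd

/-! ### Elementary inequalities for the constants -/

/-- `1 ≤ log Rmax` for `Rmax ≥ 8` (`log 8 = 3 log 2 > 2`). [folklore] -/
theorem one_le_log {Rmax : ℝ} (h : 8 ≤ Rmax) : 1 ≤ Real.log Rmax := by
  have h8 : Real.log 8 ≤ Real.log Rmax := Real.log_le_log (by norm_num) h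
  have h2 : Real.log 8 = 3 * Real.log 2 := by
    rw [show (8 : ℝ) = 2 ^ 3 by norm_num, Real.log_pow]
    norm_num
  linarith [Real.log_two_gt_d9]

/-- Monotonicity of the final exponential factor: `e^{−c₁√log R₁} ≤ e^{−c√log R₀}` for `0 ≤ c ≤ c₁`,
`0 < R₀ ≤ R₁`. [folklore] -/
theorem exp_neg_mono {c c₁ R₀ R₁ : ℝ} (hc : 0 ≤ c) (hcc : c ≤ c₁) (hR₀ : 0 < R₀) (hRR : R₀ ≤ R₁) :
    Real.exp (-(c₁ * Real.sqrt (Real.log R₁))) ≤ Real.exp (-(c * Real.sqrt (Real.log R₀))) := by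
  refine Real.exp_le_exp.2 (neg_le_neg ?_)
  exact mul_le_mul hcc (Real.sqrt_le_sqrt (Real.log_le_log hR₀ hRR)) (Real.sqrt_nonneg _) (hc.trans hcc)

/-- `∏_{p∈Q} (p/(p−1))^t ≤ ∏_{p∈Q} (p/(p−1))^{t+1}` for a set of primes `Q`. [folklore] -/
theorem prod_div_pred_pow_le_succ (Q : Finset ℕ) (hQ : ∀ p ∈ Q, p.Prime) (t : ℕ) :
    ∏ p ∈ Q, ((p : ℝ) / ((p : ℝ) - 1)) ^ t ≤ ∏ p ∈ Q, ((p : ℝ) / ((p : ℝ) - 1)) ^ (t + 1) := by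
  refine Finset.prod_le_prod (fun p _ => pow_nonneg (div_pred_nonneg p) _) fun p hp => ?_
  refine pow_le_pow_right₀ ?_ (Nat.le_succ t)
  have h := TSSPeel.one_le_div_pred_pow (hQ p hp).two_le 1
  rwa [pow_one] at h

/-! ### The induction step -/

/-- **Induction step** `TSSInduction t → TSSInduction (t + 1)` (peel, inner errors, main terms; see the file
header). [cite: GoldstonYildirim2001, Lemma 2.1] -/
theorem step (t : ℕ) (ih : TSSInduction t) : TSSInduction (t + 1) := by
  obtain ⟨c₁, hc₁, hmain⟩ := tssI_main
  obtain ⟨ct, hct, mt, κt, hκt, hIH⟩ := ih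
  obtain ⟨Lam, hLam⟩ := exists_nat_ge κt
  have hκt0 : 0 ≤ κt := zero_le_one.trans hκt
  have h2t : (1 : ℝ) ≤ 2 ^ (t + 2) := one_le_pow₀ (by norm_num)
  have hκ1 : (1 : ℝ) ≤ 2 ^ (t + 2) * κt := by nlinarith
  refine ⟨min ct c₁, lt_min hct hc₁, mt + (Lam + 1), 2 ^ (t + 2) * κt, hκ1, fun B hB => ?_⟩
  obtain ⟨Ct, hCt, hIH'⟩ := hIH B hB
  obtain ⟨C₁, hC₁, hmain'⟩ := hmain t B hB
  refine ⟨C₁ + Ct * Real.exp (4 * Lam), by positivity, ?_⟩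
  intro W Z P Q R Rmin Rmax y hP hQ hWP hoff hgen hRmin hR hy hPy hstag hQc
  -- levels
  have hRL8 : 8 ≤ R (Fin.last t) := hRmin.trans (hR _).1
  have hRL0 : 0 < R (Fin.last t) := by linarith
  have hRmin0 : 0 < Rmin := by linarith
  have hRmax8 : 8 ≤ Rmax := hRL8.trans (hR _).2
  have hL1 : 1 ≤ Real.log Rmax := one_le_log hRmax8
  have hL0 : 0 ≤ Real.log Rmax := zero_le_one.trans hL1
  -- the hypotheses of the main-term lemma at the level `R_t`
  have hPR : (∏ p ∈ P, (p : ℝ)) ^ 3 ≤ R (Fin.last t) ^ 2 := by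
    have h := hstag (Fin.last t)
    rwa [Finset.Ioi_eq_empty.2 (fun j _ => Fin.le_last j), Finset.prod_empty, one_pow, mul_one] at h
  have hQcRL : (Q.card : ℝ) ≤ B * Real.log (R (Fin.last t)) :=
    hQc.trans (mul_le_mul_of_nonneg_left (Real.log_le_log hRmin0 (hR _).1) hB)
  have hM := hmain' W Z P Q (R (Fin.last t)) y hP hQ hoff hgen hRL8 hPR hQcRL (hy _) hPy
  have hE := tssI_inner_sum t ct mt κt Ct B Lam hκt0 hLam hCt hIH' W Z P Q R Rmin Rmax y hP hQ hWP hoff hgen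
    hRmin hR hy hPy hstag hQc
  -- peel and split
  rw [tssI_gySum_peel t W Z R y]
  have hdiff : (∑ x ∈ Finset.Icc 1 ⌊R (Fin.last t)⌋₊, ((ArithmeticFunction.moebius x : ℤ) : ℝ) * Real.log (R (Fin.last t) / x) * gySum (fun i => R (Fin.castSucc i)) (gyWeight (fun q => if q ∣ x then (W q).filter (fun r => r ∈ Z q (Fin.last t)) else W q) (fun q i => Z q (Fin.castSucc i))) y) -
      ∑ x ∈ Finset.Icc 1 ⌊R (Fin.last t)⌋₊, ((ArithmeticFunction.moebius x : ℤ) : ℝ) * Real.log (R (Fin.last t) / x) * ∏ p ∈ Nat.primesBelow y, gyLocalFactor (fun q => if q ∣ x then (W q).filter (fun r => r ∈ Z q (Fin.last t)) else W q) (fun q i => Z q (Fin.castSucc i)) p =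
      ∑ x ∈ Finset.Icc 1 ⌊R (Fin.last t)⌋₊, ((ArithmeticFunction.moebius x : ℤ) : ℝ) * Real.log (R (Fin.last t) / x) * (gySum (fun i => R (Fin.castSucc i)) (gyWeight (fun q => if q ∣ x then (W q).filter (fun r => r ∈ Z q (Fin.last t)) else W q) (fun q i => Z q (Fin.castSucc i))) y - ∏ p ∈ Nat.primesBelow y, gyLocalFactor (fun q => if q ∣ x then (W q).filter (fun r => r ∈ Z q (Fin.last t)) else W q) (fun q i => Z q (Fin.castSucc i)) p) := by
    rw [← Finset.sum_sub_distrib]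
    exact Finset.sum_congr rfl fun x _ => by ring
  -- nonnegativity of the blocks
  have hΘ1 : 0 ≤ (∏ p ∈ Q, ((p : ℝ) / ((p : ℝ) - 1)) ^ (t + 1)) := Finset.prod_nonneg fun p _ => pow_nonneg (div_pred_nonneg p) _
  have hΘ0 : 0 ≤ (∏ p ∈ Q, ((p : ℝ) / ((p : ℝ) - 1)) ^ t) := Finset.prod_nonneg fun p _ => pow_nonneg (div_pred_nonneg p) _
  have hW0 : 0 ≤ (∏ p ∈ P, (((W p).card : ℝ) / p)) := Finset.prod_nonneg fun p _ => div_nonneg (Nat.cast_nonneg _) (Nat.cast_nonneg _)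
  -- comparison of the constants
  have hA1 : ((2 : ℝ) ^ (t + 1)) ^ P.card ≤ (2 ^ (t + 2) * κt) ^ P.card := by
    refine pow_le_pow_left₀ (by positivity) ?_ _
    calc (2 : ℝ) ^ (t + 1) ≤ 2 ^ (t + 2) := pow_le_pow_right₀ (by norm_num) (by omega)
      _ = 2 ^ (t + 2) * 1 := (mul_one _).symm
      _ ≤ 2 ^ (t + 2) * κt := mul_le_mul_of_nonneg_left hκt (by positivity)
  have hB1 : (κt * 2) ^ P.card ≤ (2 ^ (t + 2) * κt) ^ P.card := by
    refine pow_le_pow_left₀ (by positivity) ?_ _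
    rw [mul_comm]
    exact mul_le_mul_of_nonneg_right (by
      calc (2 : ℝ) = 2 ^ 1 := (pow_one _).symm
        _ ≤ 2 ^ (t + 2) := pow_le_pow_right₀ (by norm_num) (by omega)) hκt0
  have hA2 : 1 ≤ Real.log Rmax ^ (mt + (Lam + 1)) := one_le_pow₀ hL1
  have hA3 : Real.exp (-(c₁ * Real.sqrt (Real.log (R (Fin.last t))))) ≤ Real.exp (-(min ct c₁ * Real.sqrt (Real.log Rmin))) :=
    exp_neg_mono (le_min hct.le hc₁.le) (min_le_right _ _) hRmin0 (hR _).1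
  have hB4 : Real.exp (-(ct * Real.sqrt (Real.log Rmin))) ≤ Real.exp (-(min ct c₁ * Real.sqrt (Real.log Rmin))) :=
    exp_neg_mono (le_min hct.le hc₁.le) (min_le_left _ _) hRmin0 le_rfl
  have hB2 : (∏ p ∈ Q, ((p : ℝ) / ((p : ℝ) - 1)) ^ t) ≤ (∏ p ∈ Q, ((p : ℝ) / ((p : ℝ) - 1)) ^ (t + 1)) := prod_div_pred_pow_le_succ Q hQ t
  -- the main-term block
  have hMb : C₁ * (2 ^ (t + 1)) ^ P.card * (∏ p ∈ Q, ((p : ℝ) / ((p : ℝ) - 1)) ^ (t + 1)) * (∏ p ∈ P, (((W p).card : ℝ) / p)) * Real.exp (-(c₁ * Real.sqrt (Real.log (R (Fin.last t))))) ≤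
      C₁ * (2 ^ (t + 2) * κt) ^ P.card * (∏ p ∈ Q, ((p : ℝ) / ((p : ℝ) - 1)) ^ (t + 1)) * (∏ p ∈ P, (((W p).card : ℝ) / p)) * Real.log Rmax ^ (mt + (Lam + 1)) *
        Real.exp (-(min ct c₁ * Real.sqrt (Real.log Rmin))) := by
    have h3 : Real.exp (-(c₁ * Real.sqrt (Real.log (R (Fin.last t))))) ≤ Real.log Rmax ^ (mt + (Lam + 1)) * Real.exp (-(min ct c₁ * Real.sqrt (Real.log Rmin))) :=
      hA3.trans (le_mul_of_one_le_left (Real.exp_nonneg _) hA2)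
    calc C₁ * (2 ^ (t + 1)) ^ P.card * (∏ p ∈ Q, ((p : ℝ) / ((p : ℝ) - 1)) ^ (t + 1)) * (∏ p ∈ P, (((W p).card : ℝ) / p)) * Real.exp (-(c₁ * Real.sqrt (Real.log (R (Fin.last t)))))
        = (C₁ * (∏ p ∈ Q, ((p : ℝ) / ((p : ℝ) - 1)) ^ (t + 1)) * (∏ p ∈ P, (((W p).card : ℝ) / p))) * (((2 : ℝ) ^ (t + 1)) ^ P.card * Real.exp (-(c₁ * Real.sqrt (Real.log (R (Fin.last t)))))) := by ring
      _ ≤ (C₁ * (∏ p ∈ Q, ((p : ℝ) / ((p : ℝ) - 1)) ^ (t + 1)) * (∏ p ∈ P, (((W p).card : ℝ) / p))) * ((2 ^ (t + 2) * κt) ^ P.card *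
            (Real.log Rmax ^ (mt + (Lam + 1)) * Real.exp (-(min ct c₁ * Real.sqrt (Real.log Rmin))))) :=
          mul_le_mul_of_nonneg_left (mul_le_mul hA1 h3 (Real.exp_nonneg _) (by positivity))
            (mul_nonneg (mul_nonneg hC₁ hΘ1) hW0)
      _ = _ := by ring
  -- the inner-error block
  have hEb : Ct * κt ^ P.card * (∏ p ∈ Q, ((p : ℝ) / ((p : ℝ) - 1)) ^ t) * (∏ p ∈ P, (((W p).card : ℝ) / p)) * Real.log Rmax ^ mt * Real.exp (-(ct * Real.sqrt (Real.log Rmin))) *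
        (Real.log Rmax ^ (Lam + 1) * (2 ^ P.card * Real.exp (4 * Lam))) ≤
      Ct * Real.exp (4 * Lam) * (2 ^ (t + 2) * κt) ^ P.card * (∏ p ∈ Q, ((p : ℝ) / ((p : ℝ) - 1)) ^ (t + 1)) * (∏ p ∈ P, (((W p).card : ℝ) / p)) * Real.log Rmax ^ (mt + (Lam + 1)) *
        Real.exp (-(min ct c₁ * Real.sqrt (Real.log Rmin))) := by
    calc Ct * κt ^ P.card * (∏ p ∈ Q, ((p : ℝ) / ((p : ℝ) - 1)) ^ t) * (∏ p ∈ P, (((W p).card : ℝ) / p)) * Real.log Rmax ^ mt * Real.exp (-(ct * Real.sqrt (Real.log Rmin))) *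
          (Real.log Rmax ^ (Lam + 1) * (2 ^ P.card * Real.exp (4 * Lam)))
        = (Ct * (∏ p ∈ P, (((W p).card : ℝ) / p)) * Real.exp (4 * Lam) * Real.log Rmax ^ (mt + (Lam + 1))) *
            ((κt * 2) ^ P.card * (∏ p ∈ Q, ((p : ℝ) / ((p : ℝ) - 1)) ^ t) * Real.exp (-(ct * Real.sqrt (Real.log Rmin)))) := by
          rw [pow_add, mul_pow]; ring
      _ ≤ (Ct * (∏ p ∈ P, (((W p).card : ℝ) / p)) * Real.exp (4 * Lam) * Real.log Rmax ^ (mt + (Lam + 1))) *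
            ((2 ^ (t + 2) * κt) ^ P.card * (∏ p ∈ Q, ((p : ℝ) / ((p : ℝ) - 1)) ^ (t + 1)) * Real.exp (-(min ct c₁ * Real.sqrt (Real.log Rmin)))) :=
          mul_le_mul_of_nonneg_left
            (mul_le_mul (mul_le_mul hB1 hB2 hΘ0 (by positivity)) hB4 (Real.exp_nonneg _)
              (mul_nonneg (by positivity) hΘ1))
            (mul_nonneg (mul_nonneg (mul_nonneg hCt hW0) (Real.exp_nonneg _)) (pow_nonneg hL0 _))
      _ = _ := by ring
  -- assemble
  calc |(∑ x ∈ Finset.Icc 1 ⌊R (Fin.last t)⌋₊, ((ArithmeticFunction.moebius x : ℤ) : ℝ) * Real.log (R (Fin.last t) / x) * gySum (fun i => R (Fin.castSucc i)) (gyWeight (fun q => if q ∣ x then (W q).filter (fun r => r ∈ Z q (Fin.last t)) else W q) (fun q i => Z q (Fin.castSucc i))) y) - ∏ p ∈ Nat.primesBelow y, gyLocalFactor W Z p|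
      ≤ |(∑ x ∈ Finset.Icc 1 ⌊R (Fin.last t)⌋₊, ((ArithmeticFunction.moebius x : ℤ) : ℝ) * Real.log (R (Fin.last t) / x) * gySum (fun i => R (Fin.castSucc i)) (gyWeight (fun q => if q ∣ x then (W q).filter (fun r => r ∈ Z q (Fin.last t)) else W q) (fun q i => Z q (Fin.castSucc i))) y) -
            ∑ x ∈ Finset.Icc 1 ⌊R (Fin.last t)⌋₊, ((ArithmeticFunction.moebius x : ℤ) : ℝ) * Real.log (R (Fin.last t) / x) * ∏ p ∈ Nat.primesBelow y, gyLocalFactor (fun q => if q ∣ x then (W q).filter (fun r => r ∈ Z q (Fin.last t)) else W q) (fun q i => Z q (Fin.castSucc i)) p| +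
          |(∑ x ∈ Finset.Icc 1 ⌊R (Fin.last t)⌋₊, ((ArithmeticFunction.moebius x : ℤ) : ℝ) * Real.log (R (Fin.last t) / x) * ∏ p ∈ Nat.primesBelow y, gyLocalFactor (fun q => if q ∣ x then (W q).filter (fun r => r ∈ Z q (Fin.last t)) else W q) (fun q i => Z q (Fin.castSucc i)) p) - ∏ p ∈ Nat.primesBelow y, gyLocalFactor W Z p| := abs_sub_le _ _ _
    _ ≤ Ct * κt ^ P.card * (∏ p ∈ Q, ((p : ℝ) / ((p : ℝ) - 1)) ^ t) * (∏ p ∈ P, (((W p).card : ℝ) / p)) * Real.log Rmax ^ mt * Real.exp (-(ct * Real.sqrt (Real.log Rmin))) *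
            (Real.log Rmax ^ (Lam + 1) * (2 ^ P.card * Real.exp (4 * Lam))) +
          C₁ * (2 ^ (t + 1)) ^ P.card * (∏ p ∈ Q, ((p : ℝ) / ((p : ℝ) - 1)) ^ (t + 1)) * (∏ p ∈ P, (((W p).card : ℝ) / p)) * Real.exp (-(c₁ * Real.sqrt (Real.log (R (Fin.last t))))) := by
        rw [hdiff]
        exact add_le_add hE hM
    _ ≤ Ct * Real.exp (4 * Lam) * (2 ^ (t + 2) * κt) ^ P.card * (∏ p ∈ Q, ((p : ℝ) / ((p : ℝ) - 1)) ^ (t + 1)) * (∏ p ∈ P, (((W p).card : ℝ) / p)) * Real.log Rmax ^ (mt + (Lam + 1)) *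
            Real.exp (-(min ct c₁ * Real.sqrt (Real.log Rmin))) +
          C₁ * (2 ^ (t + 2) * κt) ^ P.card * (∏ p ∈ Q, ((p : ℝ) / ((p : ℝ) - 1)) ^ (t + 1)) * (∏ p ∈ P, (((W p).card : ℝ) / p)) * Real.log Rmax ^ (mt + (Lam + 1)) *
            Real.exp (-(min ct c₁ * Real.sqrt (Real.log Rmin))) := add_le_add hEb hMb
    _ = _ := by ring

end TSSInd

/-! ### The registered stub -/

/-- **T1b-A — the induction on the number of variables (general local data)**: `TSSInduction t` for every `t`,
by induction on `t` along the last variable (`TSSInd.base`, `TSSInd.step`). Registered stub `stub_tssInduction` of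
the line `single-moebius-split` of crux stmt-Parity-14113. [cite: GoldstonYildirim2001, Lemma 2.1] -/
theorem stub_tssInduction : ∀ t : ℕ, TSSInduction t := by
  intro t
  induction t with
  | zero => exact TSSInd.base
  | succ t ih => exact TSSInd.step t ih

end Summit.Parity.GeneralizedHardyLittlewood.Cruxes.RelativeDimOne.SingleMoebiusSplit

end
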